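import Summits.HodgeConjecture.CorCM.MultiFieldWeilPrimeSlot
import Summits.HodgeConjecture.CorCM.Census.MultiFieldWeilPureSlot
import HarnessLib

/-!
# MULTI-FIELD WEIL ENGINE — PEELING A TOWER OF PRIME SLOTS: slots of PAIRWISE DISTINCT PRIME sizes carrying ANY proper position set have constant defects,
# WHATEVER the smaller slots do; below the tower, slots whose orbits have pairwise coprime sizes are finished by joint set-transitivity — the defect law
# for «distinct primes, any types» and for «coprime one-member slots below a prime tower», NO hypothesis on the fields

Cell `pub-hodgecm2` (COR-CM), seat b30 gen 30 (2026-08-24); count-neutral own lane MULTI-FIELD WEIL ENGINE (stem `MultiFieldWeil*`), the generic capstone of the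
census toolkit of gen 29 (`Census/MultiFieldWeilPureSlot`: `const_of_signed_pure_on`, `sep_of_conj_rotate`; `CorCM/MultiFieldWeilPrimeSlot`:
`exists_pure_on_mem_realisedTuples`, `exists_conj_finRotate_of_orderOf_eq`; `Census/MultiFieldWeilSetTransitive`: `const_of_signed_jointSetTransitive_on`,
`exists_defects_of_const`; `CorCM/MultiFieldWeilCoprimeOrbits`: `exists_forall_mem_of_coprime`) — every step BY NAME.  Theorems only; no definition, no named
fact, no `sorry`, no `decide`.  `HC_CM` is NOT asserted anywhere.

THE MECHANISM.  Let the slots outside a set `L` («the tower») have pairwise distinct PRIME sizes `ℓ_m = n m`, each larger than every slot of `L`, and proper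
non-empty position sets `P m`.  Peel the tower FROM THE TOP: for a tower slot `m`, a realised tuple with `m`-component of order `ℓ_m` (Cauchy in the transitive
slot image) has a power that is the identity on every slot SMALLER than `ℓ_m` (their component orders divide `(n m')! ` and are prime to `ℓ_m`) while its
`m`-component is still an `ℓ_m`-cycle, a conjugate rotation; the slots LARGER than `ℓ_m` are tower slots already peeled, so their signed sums do not depend on
the tuple; comparing the signed equations along the powers of this element, the `ℓ_m` rotations of `P m` (read through the conjugator) have equal `d_m`-sums,
and the cyclotomic separation (`Φ_{ℓ_m}` irreducible) forces `d_m` constant (**`const_of_signed_primeTower`**, abstract `R`, stated for pairwise distinct PRIORITIES on the tower so that equal sizes can be ordered by a refinement later; **`const_of_signed_realisedTuples_primeTower`**, priorities = sizes).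
Nothing is assumed about the slots of `L` while the tower is peeled.  Then the slots of `L` are treated among themselves by joint set-transitivity
(`const_of_signed_jointSetTransitive_on L`), automatic when their position-set orbits have pairwise coprime sizes — **`exists_forall_mem_of_coprime_on`** (gen 29ʼs
counting induction restricted to `L` by blanking the tower slots, whose blank orbits have size `1`).  Packaged defect laws (the `hdef` input of
`MultiFieldWeil.hodgeConjectureFor_biproduct_comp_of_defectLawG`): **`exists_hasDefectsG_realisedTuples_of_primes`** (every slot in the tower: relative degrees
pairwise distinct primes, ANY proper non-empty position sets — `0 < |P m| < n m`) and **`exists_hasDefectsG_realisedTuples_of_primeTower_oneMember`** (one-member slots of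
pairwise coprime sizes below the tower).  Size-free forms of the two `Fin (k+1)` / `Fin (k+2)` lemmas of the toolkit at `Fin ℓ` (§1) make the induction typecheck
at the dependent slot types `Fin (n m)`.
[cite: DixonMortimer1996, §1.6 and §2.1] [cite: MoonenZarhin1995Duke, Thm. 2.4] [cite: GaoUllmo2025, Thm 3.1] [cite: Shimura1998, §18.2 Lemma (i)]

## References
* [DixonMortimer1996] J. D. Dixon, B. Mortimer, *Permutation Groups*, GTM 163, §1.6, §2.1.  [MoonenZarhin1995Duke] B. Moonen, Yu. Zarhin, Duke Math. J. 77
  (1995), Thm. 2.4.  [GaoUllmo2025] Z. Gao, E. Ullmo, J. Inst. Math. Jussieu 25 (2025), Thm 3.1.  [Shimura1998] G. Shimura, *Abelian varieties with CM and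
  modular functions*, §18.2 Lemma (i).
-/

noncomputable section

open NumberField

namespace Summit.HodgeConjecture.CorCM.MultiFieldWeil

open Finset
open Summit.HodgeConjecture.CorCM.Census.MultiFieldWeil

open scoped Classical

/-! ## §1 Size-free forms at `Fin ℓ` of two toolkit lemmas -/

section SizeFree

/-- A permutation of `ℓ` points of order `ℓ`, `ℓ` PRIME, is a conjugate of the rotation `finRotate ℓ` — `exists_conj_finRotate_of_orderOf_eq` at a free size `ℓ`.
[cite: DixonMortimer1996, §1.6] -/
theorem exists_conj_finRotate_of_orderOf_eq_prime {ℓ : ℕ} (hℓ : ℓ.Prime) (σ : Equiv.Perm (Fin ℓ)) (hσ : orderOf σ = ℓ) :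
    ∃ g : Equiv.Perm (Fin ℓ), g * finRotate ℓ * g⁻¹ = σ := by
  obtain ⟨k, rfl⟩ : ∃ k, ℓ = k + 2 := ⟨ℓ - 2, by have := hℓ.two_le; omega⟩
  exact exists_conj_finRotate_of_orderOf_eq hℓ σ hσ

/-- A conjugate rotation of `ℓ` points, `ℓ` PRIME, separates every proper non-empty position set — `sep_of_conj_rotate` at a free size `ℓ`.
[cite: DixonMortimer1996, §2.1] -/
theorem sep_of_conj_rotate_prime {ℓ : ℕ} (hℓ : ℓ.Prime) (σ g : Equiv.Perm (Fin ℓ)) {P : Finset (Fin ℓ)} (hP0 : P.Nonempty) (hPℓ : P.card < ℓ)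
    (f : Fin ℓ → ℤ) (h : ∀ j : ℕ, ∑ a ∈ preG (σ * (g * finRotate ℓ * g⁻¹) ^ j) P, f a = ∑ a ∈ preG σ P, f a) (a b : Fin ℓ) : f a = f b := by
  obtain ⟨k, rfl⟩ : ∃ k, ℓ = k + 1 := ⟨ℓ - 1, by have := hℓ.one_lt; omega⟩
  haveI : Fact (k + 1).Prime := ⟨hℓ⟩
  exact sep_of_conj_rotate σ g hP0 hPℓ f h a b

end SizeFree

/-! ## §2 Peeling a tower of prime slots (abstract set of tuples) -/

section Tower

variable {r : ℕ} {n : Fin r → ℕ} {R : Finset (PermsG n)} {P : ∀ m : Fin r, Finset (Fin (n m))}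

/-- **PEELING A TOWER OF PRIME SLOTS.**  `R ⊆ ∏_m Sym(n_m)` product-closed and non-empty; the slots outside `L` («the tower») have PRIME sizes and proper
non-empty position sets, and carry pairwise distinct priorities `prio` (in the applications `prio = n`, or a refinement of `n` when sizes repeat); for each tower
slot `m₀`, `R` contains a tuple that is the identity on every slot of `L` and on every tower slot of lower priority, with `m₀`-component of order `n m₀` (`hpure`).
Then every solution of the signed equations at the tuples of `R` has constant defect on every tower slot — nothing being assumed about the slots of `L`.  Downward
induction on the priority (each step: `const_of_signed_pure_on` with the live set `L ∪ {prio < prio m₀}`, the conjugate rotation of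
`exists_conj_finRotate_of_orderOf_eq_prime` and the cyclotomic separation `sep_of_conj_rotate_prime`). [cite: DixonMortimer1996, §1.6 and §2.1]
[cite: MoonenZarhin1995Duke, Thm. 2.4] -/
theorem const_of_signed_primeTower (hmul : ∀ π ∈ R, ∀ π' ∈ R, π * π' ∈ R) (hne : R.Nonempty) (L : Finset (Fin r)) (prio : Fin r → ℕ)
    (hpr : ∀ m, m ∉ L → (n m).Prime) (hinj : ∀ m m', m ∉ L → m' ∉ L → prio m = prio m' → m = m')
    (hP0 : ∀ m, m ∉ L → (P m).Nonempty) (hPn : ∀ m, m ∉ L → (P m).card < n m)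
    (hpure : ∀ m₀, m₀ ∉ L → ∃ ρ ∈ R, (∀ m ∈ L, ρ m = 1) ∧ (∀ m, m ∉ L → prio m < prio m₀ → ρ m = 1) ∧ orderOf (ρ m₀) = n m₀)
    {u : ℤ} {d : ∀ m : Fin r, Fin (n m) → ℤ}
    (h : ∀ π ∈ R, u + ∑ m : Fin r, ∑ a : Fin (n m), (if π m a ∈ P m then d m a else -d m a) = 0) :
    ∀ m, m ∉ L → ∀ a b : Fin (n m), d m a = d m b := by
  obtain ⟨π₀, hπ₀⟩ := hne
  -- downward induction on the priority, run as an induction on `sup prio − prio m`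
  suffices H : ∀ (N : ℕ) (m : Fin r), m ∉ L → univ.sup prio - prio m < N → ∀ a b : Fin (n m), d m a = d m b from
    fun m hm => H _ m hm (Nat.lt_succ_self _)
  intro N
  induction N with
  | zero => exact fun m _ hN => absurd hN (Nat.not_lt_zero _)
  | succ N ih =>
    intro m hm hN
    -- the live slots: `L` and the tower slots of lower priority; the other tower slots are already peeled
    set M : Finset (Fin r) := univ.filter fun m' => m' ∈ L ∨ (m' ∉ L ∧ prio m' < prio m) with hM
    have hout : ∀ m', m' ∉ M → m' ≠ m → ∀ a b : Fin (n m'), d m' a = d m' b := by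
      intro m' hm'M hm'm
      have hm'L : m' ∉ L := fun hL => hm'M (by rw [hM]; exact Finset.mem_filter.2 ⟨Finset.mem_univ _, Or.inl hL⟩)
      have h1 : ¬ prio m' < prio m := fun hlt =>
        hm'M (by rw [hM]; exact Finset.mem_filter.2 ⟨Finset.mem_univ _, Or.inr ⟨hm'L, hlt⟩⟩)
      have h2 : prio m' ≠ prio m := fun heq => hm'm (hinj m' m hm'L hm heq)
      have h3 : prio m' ≤ univ.sup prio := Finset.le_sup (f := prio) (Finset.mem_univ m')
      exact ih m' hm'L (by omega)
    obtain ⟨ρ, hρ, hρL, hρlt, hord⟩ := hpure m hm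
    have hρM : ∀ m' ∈ M, ρ m' = 1 := by
      intro m' hm'
      rw [hM] at hm'
      rcases (Finset.mem_filter.1 hm').2 with hL | ⟨hL, hlt⟩
      · exact hρL m' hL
      · exact hρlt m' hL hlt
    obtain ⟨g, hg⟩ := exists_conj_finRotate_of_orderOf_eq_prime (hpr m hm) (ρ m) hord
    refine const_of_signed_pure_on hmul M hρ hρM hπ₀ (fun f hf => ?_) hout h
    exact sep_of_conj_rotate_prime (hpr m hm) (π₀ m) g (hP0 m hm) (hPn m hm) f (fun j => by rw [hg]; exact hf j)

/-! ### Below the tower: joint set-transitivity on a SET of slots from pairwise coprime orbit sizes on that set -/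

/-- The orbit of a slot depends only on that slotʼs position set. [folklore] -/
theorem orbitG_eq_of_apply_eq {P' : ∀ m : Fin r, Finset (Fin (n m))} {m : Fin r} (hm : P' m = P m) : orbitG R P' m = orbitG R P m := by
  unfold orbitG
  rw [hm]

/-- `σ⁻¹ ∅ = ∅`. [folklore] -/
theorem preG_empty {k : ℕ} (σ : Equiv.Perm (Fin k)) : preG σ ∅ = ∅ := by
  ext a
  simp

/-- A blank slot has the one-point orbit `{∅}` (`R` non-empty). [folklore] -/
theorem orbitG_eq_singleton_empty (hne : R.Nonempty) {P' : ∀ m : Fin r, Finset (Fin (n m))} {m : Fin r} (hm : P' m = ∅) :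
    orbitG R P' m = {∅} := by
  unfold orbitG
  rw [hm]
  ext Q
  simp only [Finset.mem_image, preG_empty, Finset.mem_singleton]
  constructor
  · rintro ⟨π, -, hπ⟩
    exact hπ.symm
  · rintro rfl
    obtain ⟨π, hπ⟩ := hne
    exact ⟨π, hπ, rfl⟩

/-- **JOINT SET-TRANSITIVITY ON A SET `S` OF SLOTS from pairwise coprime orbit sizes ON `S`** (the other slots unconstrained): every tuple `(f m)_{m ∈ S}` of orbit
members is the tuple of preimages of `(P m)_{m ∈ S}` under ONE member of `R` — gen 29ʼs `exists_forall_mem_of_coprime` applied to the family blanked off `S`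
(blank orbits have size `1`, coprime to everything).  This is the `hjt` input of `Census.MultiFieldWeil.const_of_signed_jointSetTransitive_on S`.
[cite: DixonMortimer1996, §1.6 and §2.1] -/
theorem exists_forall_mem_of_coprime_on (hmul : ∀ π ∈ R, ∀ π' ∈ R, π * π' ∈ R) (hinv : ∀ π ∈ R, π⁻¹ ∈ R) (hne : R.Nonempty)
    (S : Finset (Fin r)) (hcop : ∀ m ∈ S, ∀ m' ∈ S, m ≠ m' → ((orbitG R P m).card).Coprime ((orbitG R P m').card))
    (f : ∀ m : Fin r, Finset (Fin (n m))) (hf : ∀ m ∈ S, f m ∈ orbitG R P m) :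
    ∃ π ∈ R, ∀ m ∈ S, ∀ a : Fin (n m), π m a ∈ P m ↔ a ∈ f m := by
  -- blank the slots off `S`
  let P' : ∀ m : Fin r, Finset (Fin (n m)) := fun m => if m ∈ S then P m else ∅
  have hP'S : ∀ m ∈ S, P' m = P m := fun m hm => if_pos hm
  have hP'o : ∀ m, m ∉ S → P' m = ∅ := fun m hm => if_neg hm
  have hcop' : ∀ m m' : Fin r, m ≠ m' → ((orbitG R P' m).card).Coprime ((orbitG R P' m').card) := by
    intro m m' hmm'
    by_cases hm : m ∈ S
    · by_cases hm' : m' ∈ S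
      · rw [orbitG_eq_of_apply_eq (hP'S m hm), orbitG_eq_of_apply_eq (hP'S m' hm')]
        exact hcop m hm m' hm' hmm'
      · rw [orbitG_eq_singleton_empty hne (hP'o m' hm'), Finset.card_singleton]
        exact Nat.coprime_one_right _
    · rw [orbitG_eq_singleton_empty hne (hP'o m hm), Finset.card_singleton]
      exact Nat.coprime_one_left _
  have hf' : (fun m (_ : m ∈ S) => f m) ∈ S.pi fun m => orbitG R P' m :=
    Finset.mem_pi.2 fun m hm => by
      rw [orbitG_eq_of_apply_eq (hP'S m hm)]
      exact hf m hm
  obtain ⟨π, hπ, hπf⟩ := exists_forall_mem_of_coprime (P := P') hmul hinv hne hcop' S _ hf'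
  refine ⟨π, hπ, fun m hm a => ?_⟩
  rw [← hP'S m hm]
  exact hπf m hm a

/-- **THE TOWER OVER COPRIME ORBITS (abstract `R`).**  Under the hypotheses of `const_of_signed_primeTower`, if moreover `R` is inverse-closed and the position-set
orbits of the slots of `L` have pairwise coprime sizes and separate, then EVERY slot has constant defect. [cite: DixonMortimer1996, §2.1] [cite: MoonenZarhin1995Duke, Thm. 2.4] -/
theorem const_of_signed_primeTower_coprime (hmul : ∀ π ∈ R, ∀ π' ∈ R, π * π' ∈ R) (hinv : ∀ π ∈ R, π⁻¹ ∈ R) (hne : R.Nonempty)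
    (L : Finset (Fin r)) (prio : Fin r → ℕ) (hpr : ∀ m, m ∉ L → (n m).Prime) (hinj : ∀ m m', m ∉ L → m' ∉ L → prio m = prio m' → m = m')
    (hP0 : ∀ m, m ∉ L → (P m).Nonempty) (hPn : ∀ m, m ∉ L → (P m).card < n m)
    (hpure : ∀ m₀, m₀ ∉ L → ∃ ρ ∈ R, (∀ m ∈ L, ρ m = 1) ∧ (∀ m, m ∉ L → prio m < prio m₀ → ρ m = 1) ∧ orderOf (ρ m₀) = n m₀)
    (hcop : ∀ m ∈ L, ∀ m' ∈ L, m ≠ m' → ((orbitG R P m).card).Coprime ((orbitG R P m').card))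
    (hsep : ∀ m ∈ L, ∀ f : Fin (n m) → ℤ, (∀ Q ∈ orbitG R P m, ∑ a ∈ Q, f a = ∑ a ∈ P m, f a) → ∀ a b : Fin (n m), f a = f b)
    {u : ℤ} {d : ∀ m : Fin r, Fin (n m) → ℤ}
    (h : ∀ π ∈ R, u + ∑ m : Fin r, ∑ a : Fin (n m), (if π m a ∈ P m then d m a else -d m a) = 0) :
    ∀ (m : Fin r) (a b : Fin (n m)), d m a = d m b := by
  have htop := const_of_signed_primeTower hmul hne L prio hpr hinj hP0 hPn hpure h
  have hlow : ∀ m ∈ L, ∀ a b : Fin (n m), d m a = d m b :=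
    const_of_signed_jointSetTransitive_on (R := R) (P := P) (𝒳 := orbitG R P) L (fun m _ => self_mem_orbitG (one_mem_of_closed hmul hinv hne) m)
      (fun Q hQ => exists_forall_mem_of_coprime_on hmul hinv hne L hcop Q hQ) hsep (fun m hm => htop m hm) h
  intro m
  by_cases hm : m ∈ L
  · exact hlow m hm
  · exact htop m hm

end Tower

/-! ## §3 The realised tuples: the tower is peeled with NO hypothesis on the fields -/

section Realised

variable {I : Type} {r : ℕ} {Kf : I → Type} [∀ i, Field (Kf i)] [∀ i, NumberField (Kf i)] {i₀ : I} {is : Fin r → I} {n : Fin r → ℕ}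
  {e : ∀ m : Fin r, (Kf (is m) →+* ℂ) ≃ Fin (n m) × Bool} {τ : Kf i₀ →+* ℂ} {im : ∀ m : Fin r, Kf i₀ →+* Kf (is m)}
  (he_sign : ∀ (m : Fin r) (s : Kf (is m) →+* ℂ), (e m s).2 = true ↔ s.comp (im m) = τ)

include he_sign in
/-- **The pure rotations of the tower, realised**: for a tower slot `m₀` (prime size, larger than every slot of `L`) some realised tuple is the identity on `L` and on
every tower slot of smaller size, with `m₀`-component of order `n m₀` — `exists_pure_on_mem_realisedTuples` (Cauchy in the transitive slot image + the power
trick) with the live set `{m | n m < n m₀}`.  NO Galois hypothesis. [cite: DixonMortimer1996, §1.6 and §2.1] [cite: Shimura1998, §18.2 Lemma (i)] -/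
theorem pure_realisedTuples_primeTower (L : Finset (Fin r)) (hpr : ∀ m, m ∉ L → (n m).Prime) (hLt : ∀ m ∈ L, ∀ m', m' ∉ L → n m < n m') :
    ∀ m₀, m₀ ∉ L → ∃ ρ ∈ realisedTuples e τ, (∀ m ∈ L, ρ m = 1) ∧ (∀ m, m ∉ L → n m < n m₀ → ρ m = 1) ∧ orderOf (ρ m₀) = n m₀ := by
  intro m₀ hm₀
  obtain ⟨ρ, hρ, hρM, hord⟩ := exists_pure_on_mem_realisedTuples (e := e) he_sign m₀ (hpr m₀ hm₀) (univ.filter fun m => n m < n m₀)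
    fun m hm => (Finset.mem_filter.1 hm).2
  exact ⟨ρ, hρ, fun m hm => hρM m (Finset.mem_filter.2 ⟨Finset.mem_univ _, hLt m hm m₀ hm₀⟩),
    fun m _ hlt => hρM m (Finset.mem_filter.2 ⟨Finset.mem_univ _, hlt⟩), hord⟩

include he_sign in
/-- **THE TOWER FOR THE REALISED TUPLES.**  For CM fields `K_m ⊇ i_m(k)` read by frames `e m`: if the slots outside `L` have pairwise distinct PRIME relative degrees
`n m = [K_m : k]`, each larger than every slot of `L`, and proper non-empty position sets, then every solution of the signed equations at the realised tuples has
constant defect on each of them — the pure rotations come from `exists_pure_on_mem_realisedTuples` (Cauchy + power trick); NO Galois hypothesis, nothing assumed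
about the slots of `L` or about how the fields sit together. [cite: DixonMortimer1996, §1.6 and §2.1] [cite: Shimura1998, §18.2 Lemma (i)] -/
theorem const_of_signed_realisedTuples_primeTower (L : Finset (Fin r))
    (hpr : ∀ m, m ∉ L → (n m).Prime) (hinj : ∀ m m', m ∉ L → m' ∉ L → n m = n m' → m = m')
    (hLt : ∀ m ∈ L, ∀ m', m' ∉ L → n m < n m')
    {P : ∀ m : Fin r, Finset (Fin (n m))} (hP0 : ∀ m, m ∉ L → (P m).Nonempty) (hPn : ∀ m, m ∉ L → (P m).card < n m)
    {u : ℤ} {d : ∀ m : Fin r, Fin (n m) → ℤ}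
    (h : ∀ π ∈ realisedTuples e τ, u + ∑ m : Fin r, ∑ a : Fin (n m), (if π m a ∈ P m then d m a else -d m a) = 0) :
    ∀ m, m ∉ L → ∀ a b : Fin (n m), d m a = d m b :=
  const_of_signed_primeTower (fun _ hπ _ hπ' => mul_mem_realisedTuples e τ hπ hπ') (realisedTuples_nonempty (e := e) he_sign) L n hpr hinj hP0 hPn
    (pure_realisedTuples_primeTower (e := e) he_sign L hpr hLt) h

include he_sign in
/-- **THE DEFECT LAW — PAIRWISE DISTINCT PRIME RELATIVE DEGREES, ANY TYPES** (empty `L`): for `n m` pairwise distinct primes and proper non-empty position sets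
(`0 < |P m| < n m`), every configuration balanced under the realised tuples obeys the defect law with any curve multiplicities `c m` such that
`c m = n m − 2|P m|` (as integers) — the `hdef` input of `MultiFieldWeil.hodgeConjectureFor_biproduct_comp_of_defectLawG`.  NO hypothesis on the fields.
[cite: MoonenZarhin1995Duke, Thm. 2.4] [cite: DixonMortimer1996, §2.1] -/
theorem exists_hasDefectsG_realisedTuples_of_primes (hpr : ∀ m, (n m).Prime) (hinj : Function.Injective n)
    {P : ∀ m : Fin r, Finset (Fin (n m))} (hP0 : ∀ m, (P m).Nonempty) (hPn : ∀ m, (P m).card < n m)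
    (c : Fin r → ℕ) (hc : ∀ m, ((c m : ℕ) : ℤ) = (n m : ℤ) - 2 * (P m).card)
    {α : Type} (v : α → PtG n) (T : Finset α) (hT : ModelBalancedG P (realisedTuples e τ) v T) :
    ∃ t : Fin r → ℤ, HasDefectsG c v T t := by
  have hconst := fun m : Fin r =>
    const_of_signed_realisedTuples_primeTower (e := e) he_sign ∅ (fun m _ => hpr m) (fun m m' _ _ hmm => hinj hmm)
      (fun m hm => absurd hm (Finset.notMem_empty m)) (fun m _ => hP0 m) (fun m _ => hPn m)
      (fun π hπ => signed_of_modelBalancedG (realisedTuples e τ) v hT hπ) m (Finset.notMem_empty m)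
  obtain ⟨t, hd, he⟩ := exists_defects_of_const (P := P) (realisedTuples_nonempty (e := e) he_sign) hconst
    fun π hπ => signed_of_modelBalancedG (realisedTuples e τ) v hT hπ
  refine ⟨t, fun m a => hd m a, ?_⟩
  rw [he]
  exact Finset.sum_congr rfl fun m _ => by rw [hc m]

include he_sign in
/-- **THE DEFECT LAW — ONE-MEMBER SLOTS OF PAIRWISE COPRIME SIZES BELOW A TOWER OF DISTINCT PRIMES WITH ANY TYPES**: the slots of `L` have one-member position sets
`{p}` and pairwise coprime sizes, the slots outside `L` pairwise distinct prime sizes larger than those of `L` and proper non-empty position sets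
(`0 < |P m| < n m`).  Every configuration balanced under the realised tuples obeys the defect law with any `c m = n m − 2|P m|` (as integers).  NO hypothesis on
the fields (the tower by §2, the slots of `L` by transitivity on singletons — `transitive_realisedTuples` — and `exists_forall_mem_of_coprime_on`).
[cite: MoonenZarhin1995Duke, Thm. 2.4] [cite: DixonMortimer1996, §2.1] [cite: Shimura1998, §18.2 Lemma (i)] -/
theorem exists_hasDefectsG_realisedTuples_of_primeTower_oneMember (L : Finset (Fin r))
    (hpr : ∀ m, m ∉ L → (n m).Prime) (hinj : ∀ m m', m ∉ L → m' ∉ L → n m = n m' → m = m')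
    (hLt : ∀ m ∈ L, ∀ m', m' ∉ L → n m < n m')
    (hcop : ∀ m ∈ L, ∀ m' ∈ L, m ≠ m' → (n m).Coprime (n m'))
    {P : ∀ m : Fin r, Finset (Fin (n m))} (hP1 : ∀ m ∈ L, ∃ p : Fin (n m), P m = {p})
    (hP0 : ∀ m, m ∉ L → (P m).Nonempty) (hPn : ∀ m, m ∉ L → (P m).card < n m)
    (c : Fin r → ℕ) (hc : ∀ m, ((c m : ℕ) : ℤ) = (n m : ℤ) - 2 * (P m).card)
    {α : Type} (v : α → PtG n) (T : Finset α) (hT : ModelBalancedG P (realisedTuples e τ) v T) :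
    ∃ t : Fin r → ℤ, HasDefectsG c v T t := by
  have hmul : ∀ π ∈ realisedTuples e τ, ∀ π' ∈ realisedTuples e τ, π * π' ∈ realisedTuples e τ :=
    fun π hπ π' hπ' => mul_mem_realisedTuples e τ hπ hπ'
  have hinv : ∀ π ∈ realisedTuples e τ, π⁻¹ ∈ realisedTuples e τ := fun π hπ => inv_mem_realisedTuples hπ
  have hne : (realisedTuples e τ).Nonempty := realisedTuples_nonempty (e := e) he_sign
  have htrans : ∀ (m : Fin r) (a b : Fin (n m)), ∃ π ∈ realisedTuples e τ, π m a = b := fun m a b =>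
    transitive_realisedTuples (e := e) he_sign m a b
  have hconst := const_of_signed_primeTower_coprime (P := P) hmul hinv hne L n hpr hinj hP0 hPn
    (pure_realisedTuples_primeTower (e := e) he_sign L hpr hLt)
    (fun m hm m' hm' hmm' => by
      obtain ⟨p, hp⟩ := hP1 m hm
      obtain ⟨p', hp'⟩ := hP1 m' hm'
      rw [card_orbitG_singleton hp (htrans m), card_orbitG_singleton hp' (htrans m')]
      exact hcop m hm m' hm' hmm')
    (fun m hm f hf => by
      obtain ⟨p, hp⟩ := hP1 m hm
      exact sep_of_singletons (fun a => singleton_mem_orbitG hp (htrans m) a) f hf)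
    fun π hπ => signed_of_modelBalancedG (realisedTuples e τ) v hT hπ
  obtain ⟨t, hd, he⟩ := exists_defects_of_const (P := P) hne hconst fun π hπ => signed_of_modelBalancedG (realisedTuples e τ) v hT hπ
  refine ⟨t, fun m a => hd m a, ?_⟩
  rw [he]
  exact Finset.sum_congr rfl fun m _ => by rw [hc m]

end Realised

end Summit.HodgeConjecture.CorCM.MultiFieldWeil

end
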